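import Summits.ResolutionOfSingularities.ResolutionOfSingularities.Theorems.FrobeniusClosingSteerConstOrderBinaryForm
import Literature.AlgebraicGeometry.Resolution.RegularLocalRingsNormal
import Literature.AlgebraicGeometry.Resolution.RegularSystemOfParameters
import Mathlib.Algebra.CharP.Subring
import HarnessLib

/-!
# Crux `Steer` (stmt-ResolutionOfSingularities-16345), chain W4.1: (L7) members have ENOUGH DERIVATIONS —
# the GRADED TAYLOR LEMMA over an 𝔪-adapted kernel-exact derivation frame (Theses-free, def-free)

OURS (campaign `res-hironaka`, rung L ★L-G4, slot W4.1; statements about the route's own objects; they replace the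
role of no printed item and are NOT statements of the manuscript under review [claim: Hironaka2017, status:
under-review]; AI review is weaker than expert review). Object (L7) of res-L0-w41-plan-1 RULING 84b
(HOME/STATUS 2026-08-27T10:26:03Z) for seat res-D-pv-004 (AS res-L0-w41-stub-10): supply the member binder
`H` = res-L0-w41-strat-2's `HasCleaningDerivations p (S m) (f m) (g m)` (§σ2.26 v2, res-type-096's formula verbatim)

  `∀ N, (∀ h, f − h^p ∉ 𝔪^(N+1)) → f − g^p ∈ 𝔪^N → ∃ D : Derivation ℤ S S, D f ∉ 𝔪^N ∨ ((∀ y ∈ 𝔪, D y ∈ 𝔪) ∧ D f ∉ 𝔪^(N+1))`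

for the members of the run. THIS FILE (part 1 of (L7)): `H` holds for EVERY regular local ring `S` of characteristic
`p` carrying an **𝔪-ADAPTED KERNEL-EXACT DERIVATION FRAME**: a minimal system of generators `x : Fin d → S` of `𝔪`
(`d = embdim S`), derivations `Dx i` with `Dx i (x j) = δ_ij`, and LOGARITHMIC derivations `D l` (`D l 𝔪 ⊆ 𝔪`) which are
KERNEL-EXACT ON THE RESIDUE FIELD: `(∀ l, D l c ∈ 𝔪) → ∃ b, c − b^p ∈ 𝔪`. Part 2 (the frame for regular local rings
essentially of finite type over a PERFECT field — the transversal germs of Θ1♭: `x` a regular system of parameters,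
`∂ = ∂/∂x_i`, `D l = ∂/∂u_l` for lifts `u` of a `p`-basis of the residue field; res-L0-w41-stub-4 (L7-Ω)) and the
assembly in res-D-pv-003's currency follow.

## The graded Taylor lemma (`exists_sub_pow_mem_pow_succ_of_frame`)

If `a ∈ 𝔪^N`, `Dx i a ∈ 𝔪^N` for all `i` (no non-logarithmic derivation LOWERS the order) and `D l a ∈ 𝔪^(N+1)` for all
`l` (no logarithmic one KEEPS it), then `a − h^p ∈ 𝔪^(N+1)` for some `h`. Proof: write `a = F(x)` with `F ∈ S[X]`
homogeneous of degree `N` (`exists_isHomogeneous_eval_eq_of_mem_pow`); the CHAIN RULE `D (F(x)) = Σ_i (∂_i F)(x)·D(x_i)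
+ F^D(x)` (`derivation_eval`, `F^D` = `D` applied coefficientwise) and Matsumura 17.10 (`gr_𝔪 S = κ[X]`, tree
`coeff_mem_maximalIdeal_of_eval_mem_pow`) give `∂_{X_i} F̄ = 0` in `κ[X]` and `D l (coeff m F) ∈ 𝔪` for all `m`; so every
exponent of `F̄` is divisible by `p` (res-type-026's `ConstOrder.forall_dvd_of_forall_pderiv_eq_zero`) and every
coefficient is a `p`-th power mod `𝔪` (kernel exactness): `F̄ = H̄^p`, and lifting `H` gives `a − H(x)^p ∈ 𝔪^(N+1)`
(`eval_mem_pow_succ_of_map_residue_eq_zero`). COROLLARY (`hasCleaningDerivations_of_frame`) = `H` in 096's / strat-2's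
shape, for every `f, g`: if the optimal cleaned order is exactly `N`, some `Dx i` has `Dx i f ∉ 𝔪^N` or some
(logarithmic) `D l` has `D l f ∉ 𝔪^(N+1)` (`D(g^p) = 0` in characteristic `p`). This is the abstract form of
res-D-pv-004's v3 `PthPowerOrderRaising.forall_le_order_iff_exists_sub_pow_of_kernel` (p518291, `κ⟦X⟧`), now WITHOUT
completion or Cohen structure. §3 re-declares strat-2's word `HasCleaningDerivations` VERBATIM (Subring currency) and states
the result in it (`hasCleaningDerivations_of_frame_subring`).

No Theses file is imported; nothing here is a route item or a registration. [cite: Matsumura1987, Thm. 17.10]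
[cite: Matsumura1987, Thm. 30.6]
-/

noncomputable section

-- `Summit.<S>.<S>.…` duplicates the summit name by design (single-problem summit).
set_option linter.dupNamespace false

open MvPolynomial IsLocalRing

namespace Summit.ResolutionOfSingularities.ResolutionOfSingularities.Theorems.SwitchingDichotomy.MemberDerivations

open Literature.AlgebraicGeometry.Resolution

universe u

/-! ## §1 The coefficientwise derivative `F^D` of a polynomial and the chain rule -/

section ChainRule

variable {S : Type u} [CommRing S] {d : ℕ}

/-- Coefficients of `F^D := Σ_m (D (coeff m F)) X^m`. [folklore] -/
theorem coeff_sum_monomial_derivation (D : Derivation ℤ S S) (F : MvPolynomial (Fin d) S)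
    (m : Fin d →₀ ℕ) :
    coeff m (∑ n ∈ F.support, monomial n (D (coeff n F))) = D (coeff m F) := by
  rw [coeff_sum]
  simp_rw [coeff_monomial]
  rw [Finset.sum_ite_eq']
  split_ifs with h
  · rfl
  · rw [notMem_support_iff.mp h, map_zero]

/-- `F^D` has support inside the support of `F`; in particular it is homogeneous of degree `N` if `F` is.
[folklore] -/
theorem isHomogeneous_sum_monomial_derivation (D : Derivation ℤ S S) {F : MvPolynomial (Fin d) S} {N : ℕ}
    (hF : F.IsHomogeneous N) : (∑ n ∈ F.support, monomial n (D (coeff n F))).IsHomogeneous N := by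
  intro m hm
  rw [coeff_sum_monomial_derivation] at hm
  exact hF (fun h0 => hm (by rw [h0, map_zero]))

/-- `(C c)^D = C (D c)`. [folklore] -/
theorem sum_monomial_derivation_C (D : Derivation ℤ S S) (c : S) :
    (∑ n ∈ (C c : MvPolynomial (Fin d) S).support, monomial n (D (coeff n (C c : MvPolynomial (Fin d) S)))) =
      C (D c) := by
  ext m
  rw [coeff_sum_monomial_derivation, coeff_C, coeff_C]
  split_ifs <;> simp

/-- `(F + G)^D = F^D + G^D`. [folklore] -/
theorem sum_monomial_derivation_add (D : Derivation ℤ S S) (F G : MvPolynomial (Fin d) S) :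
    (∑ n ∈ (F + G).support, monomial n (D (coeff n (F + G)))) =
      (∑ n ∈ F.support, monomial n (D (coeff n F))) + ∑ n ∈ G.support, monomial n (D (coeff n G)) := by
  ext m
  rw [coeff_add, coeff_sum_monomial_derivation, coeff_sum_monomial_derivation,
    coeff_sum_monomial_derivation, coeff_add, map_add]

/-- `(F · X_i)^D = F^D · X_i`. [folklore] -/
theorem sum_monomial_derivation_mul_X (D : Derivation ℤ S S) (F : MvPolynomial (Fin d) S) (i : Fin d) :
    (∑ n ∈ (F * X i).support, monomial n (D (coeff n (F * X i)))) =
      (∑ n ∈ F.support, monomial n (D (coeff n F))) * X i := by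
  ext m
  rw [coeff_sum_monomial_derivation, coeff_mul_X', coeff_mul_X']
  split_ifs with h
  · rw [coeff_sum_monomial_derivation]
  · rw [map_zero]

/-- **Chain rule** for a derivation through polynomial evaluation: `D (F(x)) = Σ_i (∂_i F)(x) · D (x i) + F^D(x)`,
where `F^D` is `D` applied to the coefficients. [folklore] -/
theorem derivation_eval (D : Derivation ℤ S S) (x : Fin d → S) (F : MvPolynomial (Fin d) S) :
    D (eval x F) = (∑ i, eval x (pderiv i F) * D (x i)) +
      eval x (∑ n ∈ F.support, monomial n (D (coeff n F))) := by
  induction F using MvPolynomial.induction_on with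
  | C c =>
    rw [sum_monomial_derivation_C, eval_C, eval_C]
    simp
  | add F G hF hG =>
    rw [sum_monomial_derivation_add, map_add, map_add, hF, hG, map_add]
    simp only [map_add, add_mul, Finset.sum_add_distrib]
    ring
  | mul_X F i hF =>
    have hpd : ∀ j, eval x (pderiv j (F * X i)) =
        eval x (pderiv j F) * x i + (if j = i then eval x F else 0) := by
      intro j
      rw [(pderiv j).leibniz, smul_eq_mul, smul_eq_mul, pderiv_X, Pi.single_apply, map_add, map_mul,
        map_mul, eval_X]
      by_cases h : i = j
      · subst h
        simp only [↓reduceIte, map_one]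
        ring
      · have h' : ¬ j = i := fun e => h e.symm
        simp only [h, h', ↓reduceIte, map_zero]
        ring
    rw [sum_monomial_derivation_mul_X, map_mul, eval_X, D.leibniz, smul_eq_mul, smul_eq_mul, hF, map_mul,
      eval_X]
    simp_rw [hpd, add_mul, Finset.sum_add_distrib, ite_mul, zero_mul]
    rw [Finset.sum_ite_eq' Finset.univ i (fun j => eval x F * D (x j))]
    simp only [Finset.mem_univ, if_true]
    have hs : (∑ j, eval x (pderiv j F) * x i * D (x j)) = x i * ∑ j, eval x (pderiv j F) * D (x j) := by
      rw [Finset.mul_sum]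
      exact Finset.sum_congr rfl fun j _ => by ring
    rw [hs]
    ring

end ChainRule

/-! ## §2 The graded Taylor lemma over an 𝔪-adapted kernel-exact frame -/

section Frame

/-- The residue field of a local ring of characteristic `p` (prime) has characteristic `p`. [folklore] -/
theorem charP_residueField {S : Type u} [CommRing S] [IsLocalRing S] (p : ℕ) [CharP S p] (hp' : p.Prime) :
    CharP (ResidueField S) p := by
  have h0 : ((p : ℕ) : ResidueField S) = 0 := by
    rw [← map_natCast (residue S), CharP.cast_eq_zero S p, map_zero]
  exact (CharP.charP_iff_prime_eq_zero hp').mpr h0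

variable {S : Type u} [CommRing S] [IsRegularLocalRing S] (p : ℕ) [hp : Fact p.Prime] [CharP S p]
variable {d : ℕ} (hd : (maximalIdeal S).spanFinrank = d) (x : Fin d → S)
  (hx : Ideal.span (Set.range x) = maximalIdeal S)
include hd hx

/-- **The graded Taylor lemma.** Let `S` be a regular local ring of characteristic `p` with a minimal system of
generators `x : Fin d → S` of `𝔪` (`d = embdim`), derivations `Dx i` with `Dx i (x j) = δ_ij`, and logarithmic
derivations `D l` (`D l 𝔪 ⊆ 𝔪`) that are kernel-exact on the residue field (`(∀ l, D l c ∈ 𝔪) → ∃ b, c − b^p ∈ 𝔪`).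
If `a ∈ 𝔪^N`, every `Dx i a ∈ 𝔪^N` and every `D l a ∈ 𝔪^(N+1)`, then `a − h^p ∈ 𝔪^(N+1)` for some `h ∈ S`: the initial
form of `a` is a `p`-th power in `gr_𝔪 S = κ[X]`. [cite: Matsumura1987, Thm. 17.10] -/
theorem exists_sub_pow_mem_pow_succ_of_frame (Dx : Fin d → Derivation ℤ S S)
    (hDx : ∀ i j, Dx i (x j) = if i = j then 1 else 0)
    {ι : Type*} (D : ι → Derivation ℤ S S) (hlog : ∀ l, ∀ y ∈ maximalIdeal S, D l y ∈ maximalIdeal S)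
    (hker : ∀ c : S, (∀ l, D l c ∈ maximalIdeal S) → ∃ b : S, c - b ^ p ∈ maximalIdeal S)
    {a : S} {N : ℕ} (haN : a ∈ maximalIdeal S ^ N) (hDxa : ∀ i, Dx i a ∈ maximalIdeal S ^ N)
    (hDa : ∀ l, D l a ∈ maximalIdeal S ^ (N + 1)) :
    ∃ h : S, a - h ^ p ∈ maximalIdeal S ^ (N + 1) := by
  classical
  haveI : CharP (ResidueField S) p := charP_residueField p hp.out
  -- `N = 0`: kernel exactness alone
  rcases Nat.eq_zero_or_pos N with rfl | hNpos
  · obtain ⟨b, hb⟩ := hker a (fun l => by simpa using hDa l)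
    exact ⟨b, by simpa using hb⟩
  obtain ⟨n, rfl⟩ : ∃ n, N = n + 1 := ⟨N - 1, by omega⟩
  obtain ⟨F, hF, rfl⟩ := exists_isHomogeneous_eval_eq_of_mem_pow x hx haN
  have hxmem : ∀ j, x j ∈ maximalIdeal S := fun j => hx ▸ Ideal.subset_span ⟨j, rfl⟩
  -- the coefficientwise derivatives are homogeneous of degree `n+1`, so their values lie in `𝔪^(n+1)`
  have hcoefN : ∀ (E : Derivation ℤ S S),
      eval x (∑ m ∈ F.support, monomial m (E (coeff m F))) ∈ maximalIdeal S ^ (n + 1) := fun E => by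
    rw [← hx]; exact eval_mem_span_pow x (isHomogeneous_sum_monomial_derivation E hF)
  have hhom : ∀ i, (pderiv i F).IsHomogeneous n := fun i => by
    simpa using (hF.pderiv (i := i))
  -- (A) `(∂_i F)(x) ∈ 𝔪^(n+1)`, hence `∂_{X_i} F̄ = 0` and `(∂_j F)(x) ∈ 𝔪^(n+1)` for the record
  have hpdN : ∀ i, eval x (pderiv i F) ∈ maximalIdeal S ^ (n + 1) := by
    intro i
    have hcr := derivation_eval (Dx i) x F
    have hsum : (∑ j, eval x (pderiv j F) * (Dx i) (x j)) = eval x (pderiv i F) := by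
      simp_rw [hDx i]
      rw [Finset.sum_eq_single i]
      · simp
      · intro j _ hj; simp [Ne.symm hj]
      · intro h; exact absurd (Finset.mem_univ i) h
    rw [hsum] at hcr
    have : eval x (pderiv i F) =
        Dx i (eval x F) - eval x (∑ m ∈ F.support, monomial m ((Dx i) (coeff m F))) := by
      rw [hcr]; ring
    rw [this]
    exact Ideal.sub_mem _ (hDxa i) (hcoefN (Dx i))
  have hpd0 : ∀ i, pderiv i (map (residue S) F) = 0 := fun i => by
    rw [pderiv_map]
    exact map_residue_eq_zero_of_eval_mem_pow_succ hd x hx (hhom i) (hpdN i)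
  -- (B) every coefficient of `F` is `D l`-closed modulo `𝔪`
  have hcm : ∀ l m, D l (coeff m F) ∈ maximalIdeal S := by
    intro l m
    have hcr := derivation_eval (D l) x F
    -- the `pderiv` part lies in `𝔪^(n+1) · 𝔪 ⊆ 𝔪^(n+2)`
    have h1 : (∑ j, eval x (pderiv j F) * (D l) (x j)) ∈ maximalIdeal S ^ (n + 1 + 1) := by
      refine Ideal.sum_mem _ fun j _ => ?_
      rw [pow_succ]
      exact Ideal.mul_mem_mul (hpdN j) (hlog l _ (hxmem j))
    have h2 : eval x (∑ m ∈ F.support, monomial m ((D l) (coeff m F))) ∈ maximalIdeal S ^ (n + 1 + 1) := by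
      have : eval x (∑ m ∈ F.support, monomial m ((D l) (coeff m F))) =
          D l (eval x F) - ∑ j, eval x (pderiv j F) * (D l) (x j) := by rw [hcr]; ring
      rw [this]
      exact Ideal.sub_mem _ (hDa l) h1
    have := coeff_mem_maximalIdeal_of_eval_mem_pow hd x hx (isHomogeneous_sum_monomial_derivation (D l) hF) h2 m
    rwa [coeff_sum_monomial_derivation] at this
  -- (C) `p`-th roots of the coefficients modulo `𝔪`
  choose b hb using fun m => hker (coeff m F) (fun l => hcm l m)
  -- (D) the exponents of `F̄` are divisible by `p`
  set Fbar : MvPolynomial (Fin d) (ResidueField S) := map (residue S) F with hFbar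
  have hFbarhom : Fbar.IsHomogeneous (n + 1) := hF.map _
  have hdiv : ∀ m ∈ Fbar.support, ∀ i, p ∣ m i := ConstOrder.forall_dvd_of_forall_pderiv_eq_zero p hpd0
  -- (E) the lift `H := Σ_{m ∈ supp F̄} b_m X^{m/p}` and `H^p = Σ b_m^p X^m`
  let q : (Fin d →₀ ℕ) → (Fin d →₀ ℕ) := fun m => Finsupp.mapRange (fun k => k / p) (by simp) m
  have hq : ∀ m ∈ Fbar.support, p • q m = m := by
    intro m hm
    ext i
    rw [Finsupp.smul_apply, Finsupp.mapRange_apply, smul_eq_mul, Nat.mul_div_cancel' (hdiv m hm i)]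
  set H : MvPolynomial (Fin d) S := ∑ m ∈ Fbar.support, monomial (q m) (b m) with hH
  have hHp : H ^ p = ∑ m ∈ Fbar.support, monomial m (b m ^ p) := by
    rw [hH, sum_pow_char p]
    refine Finset.sum_congr rfl fun m hm => ?_
    rw [monomial_pow, hq m hm]
  -- `H^p` is homogeneous of degree `n+1`
  have hHphom : (H ^ p).IsHomogeneous (n + 1) := by
    rw [hHp]
    refine IsHomogeneous.sum _ _ _ fun m hm => ?_
    exact isHomogeneous_monomial _ (ConstOrder.degree_eq_of_mem_support_of_isHomogeneous hFbarhom hm)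
  -- (F) `F̄ = (map residue H)^p`
  have hres : map (residue S) (H ^ p) = Fbar := by
    rw [hHp, map_sum]
    conv_rhs => rw [Fbar.as_sum]
    refine Finset.sum_congr rfl fun m _ => ?_
    rw [map_monomial, hFbar, coeff_map]
    congr 1
    rw [map_pow]
    have := hb m
    rw [← Ideal.Quotient.eq] at this
    exact this.symm
  -- (G) conclude with Matsumura 17.10
  refine ⟨eval x H, ?_⟩
  have hmap : map (residue S) (F - H ^ p) = 0 := by rw [map_sub, hres, hFbar, sub_self]
  have := eval_mem_pow_succ_of_map_residue_eq_zero x hx (hF.sub hHphom) hmap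
  simpa [map_sub, map_pow] using this

/-- **(L7, frame form) ENOUGH DERIVATIONS ⇒ `HasCleaningDerivations`** (res-L0-w41-strat-2 §σ2.26 v2 word, res-type-096's
formula verbatim, UNFOLDED): on a regular local ring `S` of characteristic `p` with an 𝔪-adapted kernel-exact derivation
frame, for all `f g` and every `N`: if NO `h` cleans `f` into `𝔪^(N+1)` while `f − g^p ∈ 𝔪^N`, then some derivation
`D : S → S` has `D f ∉ 𝔪^N`, or is logarithmic (`D 𝔪 ⊆ 𝔪`) with `D f ∉ 𝔪^(N+1)`. (Indeed one of the frame's `Dx i` /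
`D l` does; `D (g^p) = 0`.) [cite: Matsumura1987, Thm. 17.10] -/
theorem hasCleaningDerivations_of_frame (Dx : Fin d → Derivation ℤ S S)
    (hDx : ∀ i j, Dx i (x j) = if i = j then 1 else 0)
    {ι : Type*} (D : ι → Derivation ℤ S S) (hlog : ∀ l, ∀ y ∈ maximalIdeal S, D l y ∈ maximalIdeal S)
    (hker : ∀ c : S, (∀ l, D l c ∈ maximalIdeal S) → ∃ b : S, c - b ^ p ∈ maximalIdeal S)
    (f g : S) (N : ℕ) (hopt : ∀ h : S, f - h ^ p ∉ maximalIdeal S ^ (N + 1))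
    (hfg : f - g ^ p ∈ maximalIdeal S ^ N) :
    ∃ Dr : Derivation ℤ S S, Dr f ∉ maximalIdeal S ^ N ∨
      ((∀ y ∈ maximalIdeal S, Dr y ∈ maximalIdeal S) ∧ Dr f ∉ maximalIdeal S ^ (N + 1)) := by
  -- derivations kill `p`-th powers
  have hkill : ∀ E : Derivation ℤ S S, E (f - g ^ p) = E f := by
    intro E
    rw [map_sub, E.leibniz_pow, ← Nat.cast_smul_eq_nsmul S p, CharP.cast_eq_zero S p, zero_smul, sub_zero]
  by_contra hnone
  push Not at hnone
  have hDxa : ∀ i, Dx i (f - g ^ p) ∈ maximalIdeal S ^ N := fun i => by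
    rw [hkill]; exact (hnone (Dx i)).1
  have hDa : ∀ l, D l (f - g ^ p) ∈ maximalIdeal S ^ (N + 1) := fun l => by
    rw [hkill]; exact (hnone (D l)).2 (hlog l)
  obtain ⟨h, hh⟩ := exists_sub_pow_mem_pow_succ_of_frame p hd x hx Dx hDx D hlog hker hfg hDxa hDa
  refine hopt (g + h) ?_
  have : f - (g + h) ^ p = f - g ^ p - h ^ p := by rw [add_pow_char]; ring
  rwa [this]

/-- The same with the universal quantifier over `N` inside, i.e. LITERALLY the body of
`HasCleaningDerivations p S f g` (res-L0-w41-strat-2 §σ2.26 v2). [cite: Matsumura1987, Thm. 17.10] -/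
theorem hasCleaningDerivations_of_frame' (Dx : Fin d → Derivation ℤ S S)
    (hDx : ∀ i j, Dx i (x j) = if i = j then 1 else 0)
    {ι : Type*} (D : ι → Derivation ℤ S S) (hlog : ∀ l, ∀ y ∈ maximalIdeal S, D l y ∈ maximalIdeal S)
    (hker : ∀ c : S, (∀ l, D l c ∈ maximalIdeal S) → ∃ b : S, c - b ^ p ∈ maximalIdeal S) (f g : S) :
    ∀ N : ℕ, (∀ h : S, f - h ^ p ∉ maximalIdeal S ^ (N + 1)) → f - g ^ p ∈ maximalIdeal S ^ N →
      ∃ Dr : Derivation ℤ S S, Dr f ∉ maximalIdeal S ^ N ∨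
        ((∀ y ∈ maximalIdeal S, Dr y ∈ maximalIdeal S) ∧ Dr f ∉ maximalIdeal S ^ (N + 1)) :=
  fun N hopt hfg => hasCleaningDerivations_of_frame p hd x hx Dx hDx D hlog hker f g N hopt hfg

end Frame

/-! ## §3 In res-L0-w41-strat-2's words (§σ2.26 v2, `Derivation-s26v2r-strat2.r34.delta.lean` l.63, VERBATIM) -/

section Words

/-- **H · HasCleaningDerivations** — the MEMBER binder «enough derivations» (res-type-096's formula VERBATIM, res-L0-w41-plan-1
RULING 84b): whenever `g` cleans `f` to EXACT order `N` (no `h` does better), some absolute derivation `D` of `S` sees it —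
either `D f ∉ 𝔪^N` (a parameter direction) or `D` is logarithmic (`D 𝔪 ⊆ 𝔪`) with `D f ∉ 𝔪^(N+1)` (a coefficient direction).
VERBATIM copy of res-L0-w41-strat-2's §σ2.26 v2 word (only the namespace differs). OURS. [folklore] -/
def HasCleaningDerivations (p : ℕ) {L : Type} [Field L] (S : Subring L) [IsLocalRing S] (f g : S) : Prop :=
  ∀ N : ℕ, (∀ h : S, f - h ^ p ∉ maximalIdeal S ^ (N + 1)) → f - g ^ p ∈ maximalIdeal S ^ N →
    ∃ D : Derivation ℤ S S, D f ∉ maximalIdeal S ^ N ∨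
      ((∀ y ∈ maximalIdeal S, D y ∈ maximalIdeal S) ∧ D f ∉ maximalIdeal S ^ (N + 1))

/-- **(L7, frame form, in the words)**: a regular local member `S ⊆ L` (`L` a field of characteristic `p`) carrying an
𝔪-adapted kernel-exact derivation frame satisfies `HasCleaningDerivations p S f g` for ALL `f, g`.
[cite: Matsumura1987, Thm. 17.10] -/
theorem hasCleaningDerivations_of_frame_subring (p : ℕ) [Fact p.Prime] {L : Type} [Field L] [CharP L p]
    (S : Subring L) [IsRegularLocalRing S] {d : ℕ} (hd : (maximalIdeal S).spanFinrank = d) (x : Fin d → S)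
    (hx : Ideal.span (Set.range x) = maximalIdeal S) (Dx : Fin d → Derivation ℤ S S)
    (hDx : ∀ i j, Dx i (x j) = if i = j then 1 else 0)
    {ι : Type*} (D : ι → Derivation ℤ S S) (hlog : ∀ l, ∀ y ∈ maximalIdeal S, D l y ∈ maximalIdeal S)
    (hker : ∀ c : S, (∀ l, D l c ∈ maximalIdeal S) → ∃ b : S, c - b ^ p ∈ maximalIdeal S) (f g : S) :
    HasCleaningDerivations p S f g :=
  hasCleaningDerivations_of_frame' p hd x hx Dx hDx D hlog hker f g

end Words

end Summit.ResolutionOfSingularities.ResolutionOfSingularities.Theorems.SwitchingDichotomy.MemberDerivations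

end
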